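import Summits.QuantumFields.YangMills.Theorems.UnitScaleTiltProp7LocalComparisonKnit
import Summits.QuantumFields.YangMills.Theorems.UnitScaleTiltProp7QkLocalGaugeComparisonBlockSet
import Summits.QuantumFields.YangMills.Theorems.UnitScaleTiltProp7AxialLemma1
import HarnessLib

/-!
# Route `UnitScaleTilt`, crux K1 «MinimiserStabilityRegPr» (stmt-QuantumFields-19200), EX row `hGF[Lift]` (curved member) — **LOD LINE, (L6) `hcmp`-KNIT FILE B′ (MEMBER, BLOCK-SET EDITION):
# ONE FLATNESS LETTER FOR ALL THREE (L5) THIRDS** — ✓`Prop7LocalComparisonKnit.localComparison_of_cube` with its three support hypotheses `hVplaq` ((L5a)), `hVbond` ((L5b)(L5″)) and the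
# displayed `Q_k` row `hKrow` ((L5c)) ALL discharged from routeR-w4 g26's block-set letter: a set `S` of coarse blocks, `hax` («`U₀^σ` is `δ`-flat on every fine bond with both endpoint
# blocks in `S`») and `hSX` («`S` contains the block of the source of every live bond of `X` together with all its axis-neighbours»); `hKrow` by ✓`Prop7QkLocalGaugeComparisonBlockSet.
# normSq_Qk_one_conj_le_of_blockSet`.  What stays displayed: `hloc` (px5's (RB1)(RB2)(RN) via ✓`Prop7LocalProjectorRowOfMemberRows`) and `hP1abs` (★p1 ✓`Prop7RTermFloor` at `U = 1`).

Cell `ym3-torus` (HUMAN RULING D-0037, YM ladder rung R3 — NOT d = 4, NOT infinite volume, NOT a mass gap, NOT Clay).  Width seat `ym-routeR-w3` gen 12 («MINE hcmp-knit»; routeR-w4 g26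
2026-08-30 01:55:19Z «the hcmp-knitter picks ONE cube gauge σ_j per cut-off … and all three (L5) thirds read it»).  THEOREMS ONLY (0 `def`, 0 `sorry`); `--supports stmt-QuantumFields-19200 --as
helper`, count-neutral.  HONEST LABEL (★★OWNER RULING №33 (6)): curved γ-row supplier line (LOD localisation), (L6) per-cube comparison; a knit∕adapter — nothing of (3.49), Thm 3.1∕3.3∕3.11,
`h349`, `hGF`, `hT`, EX ∕ 19200 is proved here.

WHAT IS PROVED (ns `Summit.QuantumFields.YangMills.Theorems.Prop7LocalComparisonKnitBlockSet`).
* §1 `iterBlockOf_shift_or'` (the block of `x + e_μ` is the block of `x` or its `μ`-neighbour, from ✓`iterBlockOf_shift_of_face`∕`_of_not_face`), `flat_bond_of_blockSet` (`hVbond` from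
  `hax + hSX`), `flat_plaq_of_blockSet` (`hVplaq` from `hax + hSX`), `hS_of_hSX` (routeR-w4's tube letter `hS` from `hSX`).
* §2 ★★★ `localComparison_of_cube_blockSet` — `hcmp` at one cube piece with `(S, hax, hSX)` in place of `hVplaq hVbond hKrow`; `cK` = routeR-w4's constant.

References: T. Bałaban, CMP **99** (1985) 389–434 [Balaban1985BackgroundPropagators] ((3.4)–(3.16) pp.391–393, (3.20)–(3.27) pp.394–395, Thm 3.11 p.416); CMP **99** (1985) 75–102
[Balaban1985RegularSpaces] (Lemma 1 (1.25) p.79); CMP **95** (1984) 17–40 [Balaban1984PropagatorsI] ((1.6) p.18, (1.18) p.20).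
-/

set_option autoImplicit false

noncomputable section

open scoped BigOperators Matrix.Norms.L2Operator InnerProductSpace ComplexConjugate

namespace Summit.QuantumFields.YangMills.Theorems.Prop7LocalComparisonKnitBlockSet

open Literature.MathematicalPhysics.QuantumFieldTheory.Balaban1983to89
open Literature.MathematicalPhysics.QuantumFieldTheory.Balaban1983to89.T3ContinuumYM3Torus
open Literature.MathematicalPhysics.QuantumFieldTheory.Balaban1983to89.T3PrintedRegularMinimiser (RegPr)
open T4Continuum BlockAveraging
open BlockAveraging (Idx)
open B5Eq118OneStroke (iterBlockOf)
open B7Prop1Explicit (disp)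
open B10Eq27TorusAxialLog (holT transl)
open B7TransferAnalyticMean (meanCLM)
open B11Eq103H1Complex (SiteL2K BondL2K projR)
open Summit.QuantumFields.YangMills.Theorems.Prop8Chart (emlIterU)
open T3SectALandauChart (eta bgUnits)
open Summit.QuantumFields.YangMills.Theorems.Prop7SectET3Transport (periodsT3)
open Summit.QuantumFields.YangMills.Theorems.Prop7SectET3HilbertLetters (W₂ toL2 toL2S DstarL2 covLapSite)
open Summit.QuantumFields.YangMills.Theorems.Prop7SectET3WilsonHessian (DeltaEta)
open Summit.QuantumFields.YangMills.Theorems.Prop7SectET3CurvedPropagators (Qk)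
open Summit.QuantumFields.YangMills.Theorems.Prop7LocalComparisonKnit (localComparison_of_cube)
open Summit.QuantumFields.YangMills.Theorems.Prop7QkLocalGaugeComparisonBlockSet (normSq_Qk_one_conj_le_of_blockSet)
open Summit.QuantumFields.YangMills.Theorems.Prop7AxialLemma1 (iterBlockOf_shift_of_not_face)
open Summit.QuantumFields.YangMills.Theorems.Prop7AxialGaugeFace (iterBlockOf_shift_of_face)

/-! ## §1 The block-set letter discharges the three support hypotheses -/

section Geometry

variable {P : Params} {k : ℕ}

/-- The block of `x + e_μ` is the block of `x` or its `μ`-neighbour (✓`iterBlockOf_shift_of_not_face`∕`_of_face`). [cite: Balaban1984PropagatorsI, (1.6) p.18] -/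
theorem iterBlockOf_shift_or' (hk : k ≤ P.m + P.K) (x : Site P 0) (μ : Fin P.d) :
    iterBlockOf k (x.shift μ) = iterBlockOf k x ∨ iterBlockOf k (x.shift μ) = (iterBlockOf k x).shift μ := by
  by_cases hface : (x μ).val % P.L ^ k = P.L ^ k - 1
  · exact Or.inr (iterBlockOf_shift_of_face hk x μ hface)
  · exact Or.inl (iterBlockOf_shift_of_not_face hk x μ hface)

end Geometry

section Flat

variable (F : T3Family) {n K : ℕ}

/-- **`hVbond` FROM THE BLOCK-SET LETTER**: a live bond of `X` has both endpoint blocks in `S`, hence is `δ`-flat. [cite: Balaban1985RegularSpaces, Lemma 1 (1.25) p.79] -/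
theorem flat_bond_of_blockSet (σ : GaugeTransf (F.P K) 0 (Matrix.specialUnitaryGroup (Fin 2) ℂ)) (U₀ : GaugeField (F.P K) 0 (Matrix.specialUnitaryGroup (Fin 2) ℂ)) {δ : ℝ}
    (X : PBond (F.P K) 0 → Matrix (Fin 2) (Fin 2) ℂ) (S : Set (Site (F.P K) (K - n)))
    (hax : ∀ b : PBond (F.P K) 0, iterBlockOf (K - n) b.src ∈ S → iterBlockOf (K - n) b.tgt ∈ S →
      ‖((GaugeField.gaugeAct σ U₀ b : Matrix.specialUnitaryGroup (Fin 2) ℂ) : Matrix (Fin 2) (Fin 2) ℂ) - 1‖ ≤ δ)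
    (hSX : ∀ b : PBond (F.P K) 0, X b ≠ 0 → ∀ (Y : Site (F.P K) (K - n)) (μ : Fin (F.P K).d),
      (Y = iterBlockOf (K - n) b.src ∨ Y.shift μ = iterBlockOf (K - n) b.src ∨ Y = (iterBlockOf (K - n) b.src).shift μ) → Y ∈ S) :
    ∀ b : PBond (F.P K) 0, X b ≠ 0 → ‖((GaugeField.gaugeAct σ U₀ b : Matrix.specialUnitaryGroup (Fin 2) ℂ) : Matrix (Fin 2) (Fin 2) ℂ) - 1‖ ≤ δ := by
  have hk : K - n ≤ (F.P K).m + (F.P K).K := by show K - n ≤ F.m + K; omega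
  intro b hb
  refine hax b (hSX b hb _ b.dir (Or.inl rfl)) ?_
  rcases iterBlockOf_shift_or' hk b.src b.dir with e | e
  · rw [PBond.tgt, e]; exact hSX b hb _ b.dir (Or.inl rfl)
  · rw [PBond.tgt, e]; exact hSX b hb _ b.dir (Or.inr (Or.inr rfl))

/-- **`hVplaq` FROM THE BLOCK-SET LETTER**: a bond `⟨x, μ⟩` whose endpoint `x + e_μ` carries a live bond of `X` has both endpoint blocks in `S`, hence is `δ`-flat.
[cite: Balaban1985RegularSpaces, Lemma 1 (1.25) p.79] -/
theorem flat_plaq_of_blockSet (σ : GaugeTransf (F.P K) 0 (Matrix.specialUnitaryGroup (Fin 2) ℂ)) (U₀ : GaugeField (F.P K) 0 (Matrix.specialUnitaryGroup (Fin 2) ℂ)) {δ : ℝ}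
    (X : PBond (F.P K) 0 → Matrix (Fin 2) (Fin 2) ℂ) (S : Set (Site (F.P K) (K - n)))
    (hax : ∀ b : PBond (F.P K) 0, iterBlockOf (K - n) b.src ∈ S → iterBlockOf (K - n) b.tgt ∈ S →
      ‖((GaugeField.gaugeAct σ U₀ b : Matrix.specialUnitaryGroup (Fin 2) ℂ) : Matrix (Fin 2) (Fin 2) ℂ) - 1‖ ≤ δ)
    (hSX : ∀ b : PBond (F.P K) 0, X b ≠ 0 → ∀ (Y : Site (F.P K) (K - n)) (μ : Fin (F.P K).d),
      (Y = iterBlockOf (K - n) b.src ∨ Y.shift μ = iterBlockOf (K - n) b.src ∨ Y = (iterBlockOf (K - n) b.src).shift μ) → Y ∈ S) :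
    ∀ (x : Site (F.P K) 0) (μ ν : Fin (F.P K).d), μ ≠ ν → X ⟨x.shift μ, ν⟩ ≠ 0 → ‖((GaugeField.gaugeAct σ U₀ ⟨x, μ⟩ : Matrix.specialUnitaryGroup (Fin 2) ℂ) : Matrix (Fin 2) (Fin 2) ℂ) - 1‖ ≤ δ := by
  have hk : K - n ≤ (F.P K).m + (F.P K).K := by show K - n ≤ F.m + K; omega
  intro x μ ν _ hX
  have htgt : iterBlockOf (K - n) (PBond.tgt ⟨x, μ⟩) ∈ S := hSX ⟨x.shift μ, ν⟩ hX _ μ (Or.inl rfl)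
  refine hax ⟨x, μ⟩ ?_ htgt
  rcases iterBlockOf_shift_or' hk x μ with e | e
  · exact hSX ⟨x.shift μ, ν⟩ hX _ μ (Or.inl e.symm)
  · exact hSX ⟨x.shift μ, ν⟩ hX _ μ (Or.inr (Or.inl e.symm))

/-- routeR-w4 g26's tube letter `hS` (axis-neighbours in the bond's OWN direction) from `hSX` (all axis-neighbours). [folklore] -/
theorem hS_of_hSX (X : PBond (F.P K) 0 → Matrix (Fin 2) (Fin 2) ℂ) (S : Set (Site (F.P K) (K - n)))
    (hSX : ∀ b : PBond (F.P K) 0, X b ≠ 0 → ∀ (Y : Site (F.P K) (K - n)) (μ : Fin (F.P K).d),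
      (Y = iterBlockOf (K - n) b.src ∨ Y.shift μ = iterBlockOf (K - n) b.src ∨ Y = (iterBlockOf (K - n) b.src).shift μ) → Y ∈ S) :
    ∀ b : PBond (F.P K) 0, X b ≠ 0 → ∀ Y : Site (F.P K) (K - n),
      (Y = iterBlockOf (K - n) b.src ∨ Y.shift b.dir = iterBlockOf (K - n) b.src ∨ Y = (iterBlockOf (K - n) b.src).shift b.dir) → Y ∈ S :=
  fun b hb Y hY => hSX b hb Y b.dir hY

end Flat

/-! ## §2 The `hcmp` row at one cube piece, block-set edition -/

variable (F : T3Family) {n K : ℕ} (h : n ≤ K) (c₀ cB : ℝ) [Fact (0 < c₀)] [Fact (0 < cB)]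

/-- ★★★ **THE `hcmp` ROW AT ONE CUBE PIECE, BLOCK-SET EDITION**: ✓`localComparison_of_cube` with `hVplaq`, `hVbond`, `hKrow` discharged from ONE flatness letter `(S, hax, hSX)`
(`hKrow` by routeR-w4's ✓`normSq_Qk_one_conj_le_of_blockSet`, `cK := (1+θ⁻¹)·4·(3·10¹⁰L¹⁰ε₀² + 192(ℓδ)²)·cB∕(c₀ℓ^d)`); `hloc` and `hP1abs` stay displayed.
[cite: Balaban1985BackgroundPropagators, (3.4)–(3.16) pp.391–393, (3.20)–(3.27) pp.394–395, Thm 3.11 p.416; Balaban1985RegularSpaces, Lemma 1 (1.25) p.79] -/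
theorem localComparison_of_cube_blockSet {ε₀ : ℝ} (hε₀ : 0 < ε₀) (hε : 10 ^ 10 * (F.L : ℝ) ^ 6 * ε₀ ≤ 1) (hε12 : 10 ^ 12 * (F.L : ℝ) ^ 3 * ε₀ ≤ 1)
    (σ : GaugeTransf (F.P K) 0 (Matrix.specialUnitaryGroup (Fin 2) ℂ))
    (U₀ : GaugeField (F.P K) 0 (Matrix.specialUnitaryGroup (Fin 2) ℂ)) (hreg : RegPr F n K ε₀ U₀)
    (Q₀ : SiteL2K ℂ 3 (periodsT3 F K) c₀ W₂ →ₗ[ℂ] (Site (F.P K) (K - n) → Matrix (Fin 2) (Fin 2) ℂ))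
    (hseq₀ : (∀ lam : Site (F.P K) 0 → Matrix (Fin 2) (Fin 2) ℂ, ∃ ns : (j : ℕ) → Site (F.P K) j → Matrix (Fin 2) (Fin 2) ℂ, ns 0 = lam ∧
      (∀ (j : ℕ) (y : Site (F.P K) (j + 1)), ns (j + 1) y = ns j (emb y) - meanCLM (Idx (F.P K)) (Matrix (Fin 2) (Fin 2) ℂ) fun i : Idx (F.P K) =>
        ns j (emb y) - ((holT (emlIterU j (bgUnits F K U₀)) (emb y) (stairWord i.2.1 (off i.1)) : (Matrix (Fin 2) (Fin 2) ℂ)ˣ) : Matrix (Fin 2) (Fin 2) ℂ) *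
          ns j (transl (emb y) (disp (stairWord i.2.1 (off i.1)))) * (((holT (emlIterU j (bgUnits F K U₀)) (emb y) (stairWord i.2.1 (off i.1)))⁻¹ : (Matrix (Fin 2) (Fin 2) ℂ)ˣ) : Matrix (Fin 2) (Fin 2) ℂ)) ∧
      ns (K - n) = Q₀ (toL2S F K c₀ lam)))
    (Q₁ : SiteL2K ℂ 3 (periodsT3 F K) c₀ W₂ →ₗ[ℂ] (Site (F.P K) (K - n) → Matrix (Fin 2) (Fin 2) ℂ))
    (hseq₁ : (∀ lam : Site (F.P K) 0 → Matrix (Fin 2) (Fin 2) ℂ, ∃ ns : (j : ℕ) → Site (F.P K) j → Matrix (Fin 2) (Fin 2) ℂ, ns 0 = lam ∧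
      (∀ (j : ℕ) (y : Site (F.P K) (j + 1)), ns (j + 1) y = ns j (emb y) - meanCLM (Idx (F.P K)) (Matrix (Fin 2) (Fin 2) ℂ) fun i : Idx (F.P K) =>
        ns j (emb y) - ((holT (emlIterU j (bgUnits F K (GaugeField.gaugeAct σ U₀))) (emb y) (stairWord i.2.1 (off i.1)) : (Matrix (Fin 2) (Fin 2) ℂ)ˣ) : Matrix (Fin 2) (Fin 2) ℂ) *
          ns j (transl (emb y) (disp (stairWord i.2.1 (off i.1)))) * (((holT (emlIterU j (bgUnits F K (GaugeField.gaugeAct σ U₀))) (emb y) (stairWord i.2.1 (off i.1)))⁻¹ : (Matrix (Fin 2) (Fin 2) ℂ)ˣ) : Matrix (Fin 2) (Fin 2) ℂ)) ∧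
      ns (K - n) = Q₁ (toL2S F K c₀ lam)))
    (Qf : SiteL2K ℂ 3 (periodsT3 F K) c₀ W₂ →ₗ[ℂ] (Site (F.P K) (K - n) → Matrix (Fin 2) (Fin 2) ℂ))
    (X : PBond (F.P K) 0 → Matrix (Fin 2) (Fin 2) ℂ) {δ δP θ a c₆ : ℝ} (hδ : 0 ≤ δ) (hδP : 0 ≤ δP) (hθ : 0 < θ) (hsmall : 3 * θ + δP ≤ 1) (ha : 0 ≤ a)
    (S : Set (Site (F.P K) (K - n)))
    (hax : ∀ b : PBond (F.P K) 0, iterBlockOf (K - n) b.src ∈ S → iterBlockOf (K - n) b.tgt ∈ S →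
      ‖((GaugeField.gaugeAct σ U₀ b : Matrix.specialUnitaryGroup (Fin 2) ℂ) : Matrix (Fin 2) (Fin 2) ℂ) - 1‖ ≤ δ)
    (hSX : ∀ b : PBond (F.P K) 0, X b ≠ 0 → ∀ (Y : Site (F.P K) (K - n)) (μ : Fin (F.P K).d),
      (Y = iterBlockOf (K - n) b.src ∨ Y.shift μ = iterBlockOf (K - n) b.src ∨ Y = (iterBlockOf (K - n) b.src).shift μ) → Y ∈ S)
    (hloc : ‖⟪DstarL2 F n K c₀ (GaugeField.gaugeAct σ U₀) (toL2 F K c₀ (fun b => ((σ b.src : Matrix.specialUnitaryGroup (Fin 2) ℂ) : Matrix (Fin 2) (Fin 2) ℂ) * X b * star ((σ b.src : Matrix.specialUnitaryGroup (Fin 2) ℂ) : Matrix (Fin 2) (Fin 2) ℂ))),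
        (DstarL2 F n K c₀ (GaugeField.gaugeAct σ U₀) (toL2 F K c₀ (fun b => ((σ b.src : Matrix.specialUnitaryGroup (Fin 2) ℂ) : Matrix (Fin 2) (Fin 2) ℂ) * X b * star ((σ b.src : Matrix.specialUnitaryGroup (Fin 2) ℂ) : Matrix (Fin 2) (Fin 2) ℂ)))
          - projR (covLapSite F n K c₀ (GaugeField.gaugeAct σ U₀)) Q₁ (DstarL2 F n K c₀ (GaugeField.gaugeAct σ U₀) (toL2 F K c₀ (fun b => ((σ b.src : Matrix.specialUnitaryGroup (Fin 2) ℂ) : Matrix (Fin 2) (Fin 2) ℂ) * X b * star ((σ b.src : Matrix.specialUnitaryGroup (Fin 2) ℂ) : Matrix (Fin 2) (Fin 2) ℂ)))))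
        - (DstarL2 F n K c₀ (GaugeField.gaugeAct σ U₀) (toL2 F K c₀ (fun b => ((σ b.src : Matrix.specialUnitaryGroup (Fin 2) ℂ) : Matrix (Fin 2) (Fin 2) ℂ) * X b * star ((σ b.src : Matrix.specialUnitaryGroup (Fin 2) ℂ) : Matrix (Fin 2) (Fin 2) ℂ)))
          - projR (covLapSite F n K c₀ 1) Qf (DstarL2 F n K c₀ (GaugeField.gaugeAct σ U₀) (toL2 F K c₀ (fun b => ((σ b.src : Matrix.specialUnitaryGroup (Fin 2) ℂ) : Matrix (Fin 2) (Fin 2) ℂ) * X b * star ((σ b.src : Matrix.specialUnitaryGroup (Fin 2) ℂ) : Matrix (Fin 2) (Fin 2) ℂ)))))⟫_ℂ‖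
      ≤ δP * ‖DstarL2 F n K c₀ (GaugeField.gaugeAct σ U₀) (toL2 F K c₀ (fun b => ((σ b.src : Matrix.specialUnitaryGroup (Fin 2) ℂ) : Matrix (Fin 2) (Fin 2) ℂ) * X b * star ((σ b.src : Matrix.specialUnitaryGroup (Fin 2) ℂ) : Matrix (Fin 2) (Fin 2) ℂ)))‖ ^ 2)
    (hP1abs : ‖DstarL2 F n K c₀ 1 (toL2 F K c₀ (fun b => ((σ b.src : Matrix.specialUnitaryGroup (Fin 2) ℂ) : Matrix (Fin 2) (Fin 2) ℂ) * X b * star ((σ b.src : Matrix.specialUnitaryGroup (Fin 2) ℂ) : Matrix (Fin 2) (Fin 2) ℂ)))‖ ^ 2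
      ≤ ‖projR (covLapSite F n K c₀ 1) Qf (DstarL2 F n K c₀ 1 (toL2 F K c₀ (fun b => ((σ b.src : Matrix.specialUnitaryGroup (Fin 2) ℂ) : Matrix (Fin 2) (Fin 2) ℂ) * X b * star ((σ b.src : Matrix.specialUnitaryGroup (Fin 2) ℂ) : Matrix (Fin 2) (Fin 2) ℂ))))‖ ^ 2 + c₆ * ‖toL2 F K c₀ (fun b => ((σ b.src : Matrix.specialUnitaryGroup (Fin 2) ℂ) : Matrix (Fin 2) (Fin 2) ℂ) * X b * star ((σ b.src : Matrix.specialUnitaryGroup (Fin 2) ℂ) : Matrix (Fin 2) (Fin 2) ℂ))‖ ^ 2) :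
    (1 - (3 * θ + δP)) * (RCLike.re ⟪toL2 F K c₀ (fun b => ((σ b.src : Matrix.specialUnitaryGroup (Fin 2) ℂ) : Matrix (Fin 2) (Fin 2) ℂ) * X b * star ((σ b.src : Matrix.specialUnitaryGroup (Fin 2) ℂ) : Matrix (Fin 2) (Fin 2) ℂ)), DeltaEta F n K c₀ 1 (toL2 F K c₀ (fun b => ((σ b.src : Matrix.specialUnitaryGroup (Fin 2) ℂ) : Matrix (Fin 2) (Fin 2) ℂ) * X b * star ((σ b.src : Matrix.specialUnitaryGroup (Fin 2) ℂ) : Matrix (Fin 2) (Fin 2) ℂ)))⟫_ℂ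
          + ‖projR (covLapSite F n K c₀ 1) Qf (DstarL2 F n K c₀ 1 (toL2 F K c₀ (fun b => ((σ b.src : Matrix.specialUnitaryGroup (Fin 2) ℂ) : Matrix (Fin 2) (Fin 2) ℂ) * X b * star ((σ b.src : Matrix.specialUnitaryGroup (Fin 2) ℂ) : Matrix (Fin 2) (Fin 2) ℂ))))‖ ^ 2
          + a * ‖Qk F n K h c₀ cB (1 : GaugeField (F.P K) 0 (Matrix.specialUnitaryGroup (Fin 2) ℂ)) (toL2 F K c₀ (fun b => ((σ b.src : Matrix.specialUnitaryGroup (Fin 2) ℂ) : Matrix (Fin 2) (Fin 2) ℂ) * X b * star ((σ b.src : Matrix.specialUnitaryGroup (Fin 2) ℂ) : Matrix (Fin 2) (Fin 2) ℂ)))‖ ^ 2)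
        - (((1 + θ⁻¹) * (16 * ((eta F n K)⁻¹) ^ 2 * δ ^ 2) + (1 + θ) * (1029 * ε₀)) + (1 + θ⁻¹) * (12 * ((eta F n K)⁻¹) ^ 2 * δ ^ 2)
            + (1 + θ⁻¹) * (12 * ((eta F n K)⁻¹) ^ 2 * δ ^ 2) + a * ((1 + θ⁻¹) * (4 * (3 * 10 ^ 10 * (F.L : ℝ) ^ 10 * ε₀ ^ 2 + 192 * ((F.L : ℝ) ^ (K - n) * δ) ^ 2) * (cB / (c₀ * ((F.L : ℝ) ^ (K - n)) ^ (F.P K).d)))) + (2 * θ + δP) * c₆) * ‖toL2 F K c₀ X‖ ^ 2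
      ≤ RCLike.re ⟪toL2 F K c₀ X, DeltaEta F n K c₀ U₀ (toL2 F K c₀ X)⟫_ℂ
          + ‖projR (covLapSite F n K c₀ U₀) Q₀ (DstarL2 F n K c₀ U₀ (toL2 F K c₀ X))‖ ^ 2
          + a * ‖Qk F n K h c₀ cB U₀ (toL2 F K c₀ X)‖ ^ 2 := by
  have hc₀ : 0 < c₀ := Fact.out
  have hcB : 0 < cB := Fact.out
  have hL : 0 < (F.L : ℝ) := by have := F.hL.2; exact_mod_cast (by omega : 0 < F.L)
  have hcK : (0 : ℝ) ≤ ((1 + θ⁻¹) * (4 * (3 * 10 ^ 10 * (F.L : ℝ) ^ 10 * ε₀ ^ 2 + 192 * ((F.L : ℝ) ^ (K - n) * δ) ^ 2) * (cB / (c₀ * ((F.L : ℝ) ^ (K - n)) ^ (F.P K).d)))) := by positivity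
  have hKrow := normSq_Qk_one_conj_le_of_blockSet F n K h c₀ cB hε₀ hε hε12 U₀ hreg σ hδ X S hax (hS_of_hSX F X S hSX) hθ
  exact localComparison_of_cube F h c₀ cB hε₀.le σ U₀ hreg Q₀ hseq₀ Q₁ hseq₁ Qf X hδ hδP hθ hsmall ha hcK
    (flat_plaq_of_blockSet F σ U₀ X S hax hSX) (flat_bond_of_blockSet F σ U₀ X S hax hSX) hloc hKrow hP1abs

end Summit.QuantumFields.YangMills.Theorems.Prop7LocalComparisonKnitBlockSet

end
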